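import Mathlib
import Summits.NavierStokesRegularity.NavierStokesRegularity.Theorems.PowerGaugeEulerLiouville.Negative.RelaxingFlowFatVorticity
import Summits.NavierStokesRegularity.NavierStokesRegularity.Theorems.PowerGaugeEulerLiouville.Negative.ForwardRelaxingClassicalFlow

/-!
# Crux `EulerZoomLiouville.PowerGaugeEulerLiouville` (stmt-NavierStokesRegularity-19832) — the ANCIENT refutation door has
# FAT VORTICITY too (time-reversed twin of `…Negative.RelaxingFlowFatVorticity`)

Negative-lane structure record (prover hand leafhand-ns-eulerzoomliouville-8 g0; `--supports` stmt-19832).  Door (A) of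
`…Negative.BudgetedClassicalAncientFlow` is a nonzero classical ancient Euler flow on `(−∞,0) × ℝ³` with three finite
global budgets, among them the space–time enstrophy `∫∫_{(−∞,0)×ℝ³}|∇u|²_F < ∞`.  By time reversal
(`u(t,x) ↦ −u(−t,x)`, kinematic) the forward fat-vorticity law transfers:

* `setLIntegral_enstrophy_eq_top_of_energyFloor_ancient` — a jointly `C¹` velocity on `(−∞,0) × ℝ³` with `C²`
  divergence-free `L²` slices, an energy floor `E₀ > 0` and compactly supported vorticity slices of volume `≤ V₀ < ∞`
  has `∫∫_{(−∞,0)×ℝ³}|∇u|²_F = ∞`;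
* `no_thinVorticity_budgetedAncientEulerFlow` — hence a classical ancient Euler flow in door (A) (finite space–time
  enstrophy budget) with an energy floor never has thin compactly supported vorticity.  For classical Euler flows with
  `L² ∩ L³` slices and `|p||u| ∈ L¹` the energy is conserved on `(−∞,0)` (tree
  `FiniteEnergy.integral_norm_sq_eq_of_classical_euler`), so the floor is the energy itself; it enters here as a
  hypothesis.

WHAT THIS IS NOT: not a refutation or proof of the crux, of a stub, or of the route; not a claim about Navier–Stokes.
[folklore] -/

noncomputable section
set_option linter.dupNamespace false
namespace Summit.NavierStokesRegularity.NavierStokesRegularity.Theorems.PowerGaugeEulerLiouville.Negative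

open MeasureTheory Set Function Filter Topology Metric Literature.Analysis Literature.Analysis.FluidPDE
open scoped NNReal ENNReal

/-- `curl (−w) = −curl w` (the curl is linear in the Fréchet derivative). [folklore] -/
theorem curl_neg_field (w : EuclideanSpace ℝ (Fin 3) → EuclideanSpace ℝ (Fin 3)) :
    curl (fun x => -w x) = fun x => -curl w x := by
  funext x
  rw [curl_eq_curlCLM, curl_eq_curlCLM, fderiv_fun_neg, map_neg]

/-- **ENERGY FLOOR + THIN VORTICITY ⇒ INFINITE SPACE–TIME ENSTROPHY, ancient form.**  Time-reversed twin of
`setLIntegral_enstrophy_eq_top_of_energyFloor`. [folklore] -/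
theorem setLIntegral_enstrophy_eq_top_of_energyFloor_ancient
    {u : ℝ → EuclideanSpace ℝ (Fin 3) → EuclideanSpace ℝ (Fin 3)}
    (hu : ContDiffOn ℝ 1 (uncurry u) (Iio (0 : ℝ) ×ˢ (univ : Set (EuclideanSpace ℝ (Fin 3)))))
    (hC2 : ∀ t : ℝ, t < 0 → ContDiff ℝ 2 (u t)) (hdiv : ∀ t : ℝ, t < 0 → VectorCalculus.IsDivFree (u t))
    (hfin : ∀ t : ℝ, t < 0 → ∫⁻ x, ‖u t x‖ₑ ^ 2 < ⊤)
    (hωfin : ∀ t : ℝ, t < 0 → ∫⁻ x, ‖curl (u t) x‖ₑ ^ 2 < ⊤)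
    (hcpt : ∀ t : ℝ, t < 0 → HasCompactSupport (curl (u t)))
    {E₀ V₀ : ℝ≥0∞} (hE₀ : E₀ ≠ 0) (hV₀ : V₀ ≠ ⊤)
    (hfloor : ∀ t : ℝ, t < 0 → E₀ ≤ ∫⁻ x, ‖u t x‖ₑ ^ 2)
    (hvol : ∀ t : ℝ, t < 0 → volume (Function.support (curl (u t))) ≤ V₀) :
    ∫⁻ z in Iio (0 : ℝ) ×ˢ (univ : Set (EuclideanSpace ℝ (Fin 3))),
      ENNReal.ofReal (frobeniusNormSq (fderiv ℝ (u z.1) z.2)) = ⊤ := by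
  have hfrob : ∀ A : EuclideanSpace ℝ (Fin 3) →L[ℝ] EuclideanSpace ℝ (Fin 3),
      frobeniusNormSq (-A) = frobeniusNormSq A := fun A => by
    simp [frobeniusNormSq]
  -- the time-reversed velocity on `(0,∞)`
  set v : ℝ → EuclideanSpace ℝ (Fin 3) → EuclideanSpace ℝ (Fin 3) := fun s x => -u (-s) x with hvdef
  have hR : ContDiff ℝ 1 (fun z : ℝ × EuclideanSpace ℝ (Fin 3) => ((-z.1, z.2) : ℝ × EuclideanSpace ℝ (Fin 3))) :=
    (contDiff_fst.neg).prodMk contDiff_snd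
  have hmaps : MapsTo (fun z : ℝ × EuclideanSpace ℝ (Fin 3) => ((-z.1, z.2) : ℝ × EuclideanSpace ℝ (Fin 3)))
      (Ioi (0 : ℝ) ×ˢ (univ : Set (EuclideanSpace ℝ (Fin 3)))) (Iio (0 : ℝ) ×ˢ (univ : Set (EuclideanSpace ℝ (Fin 3)))) :=
    fun z hz => show ((-z.1, z.2) : ℝ × EuclideanSpace ℝ (Fin 3)) ∈ Iio (0 : ℝ) ×ˢ (univ : Set (EuclideanSpace ℝ (Fin 3)))
      from ⟨neg_lt_zero.mpr (show 0 < z.1 from hz.1), mem_univ _⟩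
  have hv : ContDiffOn ℝ 1 (uncurry v) (Ioi (0 : ℝ) ×ˢ (univ : Set (EuclideanSpace ℝ (Fin 3)))) := by
    show ContDiffOn ℝ 1 (fun z : ℝ × EuclideanSpace ℝ (Fin 3) => -(uncurry u (-z.1, z.2)))
      (Ioi (0 : ℝ) ×ˢ (univ : Set (EuclideanSpace ℝ (Fin 3))))
    exact (hu.comp hR.contDiffOn hmaps).neg
  have hcurl : ∀ s : ℝ, curl (v s) = fun x => -curl (u (-s)) x := fun s => curl_neg_field (u (-s))
  have hsupp : ∀ s : ℝ, Function.support (curl (v s)) = Function.support (curl (u (-s))) := by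
    intro s
    rw [hcurl]
    exact Function.support_neg (curl (u (-s)))
  have hC2' : ∀ s : ℝ, 0 < s → ContDiff ℝ 2 (v s) := fun s hs => (hC2 (-s) (neg_lt_zero.mpr hs)).neg
  have hdiv' : ∀ s : ℝ, 0 < s → VectorCalculus.IsDivFree (v s) := fun s hs =>
    isDivFree_neg_field (hdiv (-s) (neg_lt_zero.mpr hs))
  have hfin' : ∀ s : ℝ, 0 < s → ∫⁻ x, ‖v s x‖ₑ ^ 2 < ⊤ := by
    intro s hs
    simpa only [hvdef, enorm_neg] using hfin (-s) (neg_lt_zero.mpr hs)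
  have hωfin' : ∀ s : ℝ, 0 < s → ∫⁻ x, ‖curl (v s) x‖ₑ ^ 2 < ⊤ := by
    intro s hs
    rw [hcurl s]
    simpa only [enorm_neg] using hωfin (-s) (neg_lt_zero.mpr hs)
  have hcpt' : ∀ s : ℝ, 0 < s → HasCompactSupport (curl (v s)) := by
    intro s hs
    rw [hcurl s]
    exact (hcpt (-s) (neg_lt_zero.mpr hs)).neg
  have hfloor' : ∀ s : ℝ, 0 < s → E₀ ≤ ∫⁻ x, ‖v s x‖ₑ ^ 2 := by
    intro s hs
    simpa only [hvdef, enorm_neg] using hfloor (-s) (neg_lt_zero.mpr hs)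
  have hvol' : ∀ s : ℝ, 0 < s → volume (Function.support (curl (v s))) ≤ V₀ := by
    intro s hs
    rw [hsupp s]
    exact hvol (-s) (neg_lt_zero.mpr hs)
  have hfwd := setLIntegral_enstrophy_eq_top_of_energyFloor hv hC2' hdiv' hfin' hωfin' hcpt' hE₀ hV₀ hfloor' hvol'
  -- transfer back by the time reflection
  have key := setLIntegral_timeReversal
    (fun w : ℝ × EuclideanSpace ℝ (Fin 3) => ENNReal.ofReal (frobeniusNormSq (fderiv ℝ (v w.1) w.2)))
  rw [hfwd] at key
  rw [← key]
  refine lintegral_congr fun z => ?_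
  simp only [hvdef, neg_neg, fderiv_fun_neg, hfrob]

/-- **NO THIN-VORTICITY BUDGETED ANCIENT EULER FLOW.**  A classical Euler flow `(u,p)` on `(−∞,0) × ℝ³` with `L²`
slices of finite enstrophy, an energy floor `E₀ > 0`, compactly supported vorticity slices of volume `≤ V₀ < ∞`, and a
finite space–time enstrophy budget `∫∫_{(−∞,0)×ℝ³}|∇u|²_F ≤ M` does not exist: door (A) of
`…Negative.BudgetedClassicalAncientFlow` contains no flow with an energy floor and thin compactly supported vorticity.
[folklore] -/
theorem no_thinVorticity_budgetedAncientEulerFlow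
    {u : ℝ → EuclideanSpace ℝ (Fin 3) → EuclideanSpace ℝ (Fin 3)} {p : ℝ → EuclideanSpace ℝ (Fin 3) → ℝ} {M : ℝ≥0}
    (hsol : IsClassicalEulerSolutionOn (Iio (0 : ℝ)) 0 u p)
    (hfin : ∀ t : ℝ, t < 0 → ∫⁻ x, ‖u t x‖ₑ ^ 2 < ⊤)
    (hωfin : ∀ t : ℝ, t < 0 → ∫⁻ x, ‖curl (u t) x‖ₑ ^ 2 < ⊤)
    (hcpt : ∀ t : ℝ, t < 0 → HasCompactSupport (curl (u t)))
    {E₀ V₀ : ℝ≥0∞} (hE₀ : E₀ ≠ 0) (hV₀ : V₀ ≠ ⊤)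
    (hfloor : ∀ t : ℝ, t < 0 → E₀ ≤ ∫⁻ x, ‖u t x‖ₑ ^ 2)
    (hvol : ∀ t : ℝ, t < 0 → volume (Function.support (curl (u t))) ≤ V₀)
    (hE : ∫⁻ z in Iio (0 : ℝ) ×ˢ (univ : Set (EuclideanSpace ℝ (Fin 3))),
      ENNReal.ofReal (frobeniusNormSq (fderiv ℝ (u z.1) z.2)) ≤ (M : ℝ≥0∞)) : False := by
  have huInf : ContDiffOn ℝ (⊤ : ℕ∞) (uncurry u) (Iio (0 : ℝ) ×ˢ (univ : Set (EuclideanSpace ℝ (Fin 3)))) :=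
    hsol.smooth_velocity
  have hu : ContDiffOn ℝ 1 (uncurry u) (Iio (0 : ℝ) ×ˢ (univ : Set (EuclideanSpace ℝ (Fin 3)))) :=
    huInf.of_le (by norm_cast)
  have hC2 : ∀ t : ℝ, t < 0 → ContDiff ℝ 2 (u t) := fun t ht =>
    (hsol.contDiff_velocity (show t ∈ Iio (0 : ℝ) from ht)).of_le (by norm_cast)
  have hdiv : ∀ t : ℝ, t < 0 → VectorCalculus.IsDivFree (u t) := fun t ht => hsol.divFree t ht
  have h := setLIntegral_enstrophy_eq_top_of_energyFloor_ancient hu hC2 hdiv hfin hωfin hcpt hE₀ hV₀ hfloor hvol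
  rw [h] at hE
  exact ENNReal.coe_ne_top (top_le_iff.1 hE)

end Summit.NavierStokesRegularity.NavierStokesRegularity.Theorems.PowerGaugeEulerLiouville.Negative
end
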